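import Mathlib.NumberTheory.LegendreSymbol.JacobiSymbol
import Literature.NumberTheory.EllipticCurves.Sakamoto2024.KuriharaStructureAtThree
import Literature.NumberTheory.EllipticCurves.QuadraticTwist
import Literature.NumberTheory.EllipticCurves.RootNumber
import Literature.NumberTheory.EllipticCurves.PAdicLFunction
import HarnessLib

/-!
# Cell `bsd-f1-sign2` (`p = 2`, non-CM) — Euler-system lens (seat `-es`) g1: KURIHARA NUMBERS AT TWO —
# Kurihara's structure conjecture stated at `p = 2` (candidate ES-K2-C `KuriharaStructureAtTwo`, crux-grade;
# slice ES-K2-C₂ `…DepthTwo`; ES-K2-D `KuriharaDepthLawAtTwo`; ES-K2-E `TamagawaDefectAtTwo`; targets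
# K2-A1 `PrimeLevelDictionary`, K2-A2 `PairLevelDictionary`, K2-B `LayerOneVanishingAtTwo`)

HONEST FRAMING (typer seat `bsd-f1-sign2-ty`; HOME `run/shared/lean/pub/bsd-f1-sign2/`, CANDIDATES.md §2
rows ES-K2-C/C₂/D/E): STATEMENTS ONLY — carriers = definitions with bodies over tree symbols
(`twistSymbolSum f d`, `kuriharaSumTwo f n` (canonical quadratic `ψ_ℓ`), `IsEvenRat`, `IsOddRat`,
`IsDeltaMinimalTwo f d`, `IsLevelAtTwo W d`, the hypothesis package `HypothesesAtTwo W` (a `structure … :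
Prop`), `PeriodTransferAtTwo W f`), seven `@[conjecture] def`s (OPEN obligations of ours: K2-C crux-grade
conjecture NEW AT `p = 2`; K2-C₂ slice with a proof path; K2-D one-row-killable candidate; K2-E candidate;
K2-A1/A2/B THEOREM-GRADE dictionary/target statements a prover can take) and two PROVED sanity theorems
(`kuriharaSumTwo_one`, `not_isOddRat_of_structure`: structure ⇒ depth law where lower levels are even);
nothing asserted, nothing booked, no named fact, PARTITION: none moved. Source: `HOME/data-es/SketchK2.lean`
sha16 6214b58aedc90e46 (planner bsd-f1-sign2-es g1; `lean check` rc 0, 0 sorry; BC7 pre-audit CLEAN ×4 in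
seat), re-filed VERBATIM (namespace moved from `…BirchSwinnertonDyer.F1Sign2ES` to the cell's
`…Rank1Residual.F1Sign2`; `@[conjecture]` tags added; `import Mathlib` narrowed). REFUTER PASS: REF1-AUDIT-v1 §9.2/§9.6 (batch 3, 2026-08-27T15:41Z): **7/7 SURVIVE** (K2-A1/A2/B
theorem-grade; K2-C/C₂/D/E conjecture-grade; read-back notes non-blocking, e.g. `twistSymbolSum f d` sums over
`ZMod (d+1)`; lint :215 unused simp argument — fixed here, the only non-verbatim line, inside a proof).
REF2-PLACEMENT-v3 §0: K2-A1/A2 PROVABLE / IN-PRINT-ASSEMBLY, K2-B IN-PRINT-ASSEMBLY (lemmas); **K2-C/C₂, K2-D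
= P-ODD-ONLY ⇒ OPEN at 2** (open core (γ) of the cell: no p = 2 Kolyvagin-system / Kurihara-number source;
MR04 (H.4) needs p > 4, complex conjugation has order p at p = 2); K2-E: mechanism IN PRINT for p > 3 and one
Tamagawa factor (Büyükboduk 2009), several factors = Büyükboduk Question 1 OPEN ⇒ at 2 an OPEN
transposition; ν ≤ 1 slice = BSD bookkeeping.

BC5 WITNESS (table `HOME/data-es/KUR2-v1.tsv` sha16 26d3f1140543ade8, 16 096 `(E, n)` rows, script
`data-es/kur2.py` 038bdcca0949350a, Cremona `allbsd` N < 5·10⁵, `N·n² < 5·10⁵`): (L0) `κ_n` 2-integral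
16 096/16 096; (L1 = K2-D) `κ_n` odd ⇒ `ν(n) ≥ s₂(E)`: **0 violations on the 723 rows with ν(n) < s₂(E)**
(HONESTY CLAUSE: all 723 are `(ν, s₂) = (1, 2)`, the regime explained by bookkeeping + BSD of the twist; no
row with `2 ≤ ν < s₂` reachable ⇒ the real test is data ask D-es-5); (L2 = K2-E) `2 ∣ ∏c_q` ⇒ every `κ_n`
even: **0 odd among 8 101 rows**; (L3) 3 δ-minimal `s₂ = 2` witnesses 571a1·21, 433a1·33, 571b1·21, all
`#Sel₂ = 4` ✓ (571a1: `a₂ = 0` good ss, r = 0, Tam 1, Ш_an = 4, `κ_21 = 1` — Kato's Kolyvagin system mod 2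
is a UNIT at the predicted depth, with no ± object anywhere); (L4 = K2-B) 1 604/1 604; (L6) the v0 typing of
K2-C₂ was REFUTED in seat by 27a1·85, 37b1·65 (non-δ-minimal) → repaired with `IsDeltaMinimalTwo`.
CHEAPEST FALSIFIER: one δ-minimal level with `#Sel₂ ≠ 2^{ν(d)}` → 0/3 + 0/723 shadow (NOT KILLED). WHY
NOVEL (MEMO-es §8): Kurihara 2014 / Kim 2022 / Sakamoto 2024 are `p ≥ 5`, `p ≥ 5`, `p = 3`; `p = 2` is not in
print (Kim: «the p ≥ 5 condition is required only for the Chebotarev density type argument»); MR (H.4) bites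
K2-C in general — the bet is K2-C₂ needs no Kolyvagin-system theory (BSD₂-upper for ONE Sel₂-trivial twist +
an `H¹(ℚ,E[2])` comparison).

References: [Kurihara2014] (1)/(2), §1.1; [Sakamoto2024] Def. 1.4, Thm 9.11(2), Lemma 9.9 (p = 3 template,
tree `Sakamoto2024.KuriharaStructureAtThree`); [MazurRubin2004] (H.4); HOME MEMO-es.md §§7–8 (file
15:14Z), data-es/SketchK2.lean 6214b58aedc90e46.

## The planner's sketch docstring (verbatim)
# F1Sign2ES v1.1 — Kolyvagin / Kurihara numbers AT TWO (cell bsd-f1-sign2, seat -es, gen 1)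

Sketch (seat-local, not a tree file).  At `p = 2`, `k = 1` the discrete logarithm
`ψ_ℓ : (ℤ/ℓ)ˣ ↠ ℤ/2` is CANONICAL — the quadratic character, `ψ_ℓ(a) = (1 − (a/ℓ))/2` — and the
Kolyvagin derivative `D_σ = ∑ i σ^i ≡ ∑_{i odd} σ^i (mod 2)` is the genus-theory projector.  Hence the
mod-`2` Kurihara number of a weight-2 rational newform `f` at a square-free level `n` (product of
primes `ℓ ∤ 2N` with `a_ℓ` even) is an explicit signed combination of the algebraic central values
of the QUADRATIC TWISTS `f ⊗ χ_d`, `d ∣ n`, `d ≡ 1 (mod 4)`: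
  `2^{ν(n)} · κ_n(f) = ∑_{d ∣ n} (−1)^{ν(d)} (∏_{ℓ ∣ n/d} (a_ℓ − 2 (ℓ/d))) · T_d(f)`,
  `T_d(f) := ∑_{a mod d} (a/d) [a/d]⁺_f` (`= √d · L(f, χ_d, 1)/Ω⁺_f` for `d ≡ 1 (4)` by the tree's
  signed Birch formula `ratTwistedSymbolSum_jacobiChar_mul_plusPeriod`, `= 0` for `d ≡ 3 (4)`).
We work with the RATIONAL sum `kuriharaSumTwo f n ∈ ℚ` and its `2`-adic valuation, because the
individual plus symbols `[a/n]⁺_f` are only in `½ℤ_(2)` (e.g. `[1/3]⁺_{11a} = −3/10`), so the tree's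
term-wise reduction `kuriharaNumber f 2 n ψ` (via `ratModP 2`) is junk-valued at `p = 2`; the sum
itself is `2`-integral on all 16 096 `(E, n)` pairs of the seat's table `KUR2-v1`.
Nothing here is asserted; every `def … : Prop` is a candidate statement.
-/

set_option autoImplicit false

noncomputable section

open scoped Classical MatrixGroups ModularForm

open CongruenceSubgroup WeierstrassCurve Literature.NumberTheory.EllipticCurves
  Literature.NumberTheory.EllipticCurves.ModularForms

namespace Summit.BirchSwinnertonDyer.Rank1Residual.F1Sign2

/-! ## §1 Rational objects at `p = 2` -/

section Rational

variable {N : ℕ} (f : CuspForm (Gamma0 N) 2)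

/-- `T_d(f) = ∑_{a mod d} (a/d)·[a/d]⁺_f ∈ ℚ` — the rational quadratic-twist symbol sum (Jacobi symbol
`jacobiSym`; `T_1 = [0]⁺ = L(f,1)/Ω⁺_f`).  For `d ≡ 1 (mod 4)` square-free it is
`√d·L(f,χ_d,1)/Ω⁺_f = L(E^{(d)},1)/Ω(E^{(d)})` (signed Birch formula; naive twist of a minimal model by
`d ≡ 1 (4)`, `(d, N) = 1`, is minimal). -/
def twistSymbolSum (d : ℕ) : ℚ :=
  ∑ a : ZMod d.succPNat, (jacobiSym (a.val : ℤ) d : ℚ) * ratPlusSymbol f ((a.val : ℚ) / d)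

/-- The **rational Kurihara sum at two** `κ_n(f) = ∑_{a ∈ (ℤ/n)ˣ} [a/n]⁺_f · ∏_{ℓ ∣ n} (1 − (a/ℓ))/2 ∈ ℚ`
(canonical `ψ_ℓ = ` quadratic character; for `n = 1` this is `[0]⁺_f`).  Its class mod `2` — when
`2`-integral — is the mod-`2` Kurihara number `δ̃_n` of Kurihara 2014 (1)/(2) at `p = 2`. -/
def kuriharaSumTwo (n : ℕ) [NeZero n] : ℚ :=
  ∑ a : (ZMod n)ˣ, ratPlusSymbol f ((((a : ZMod n).val : ℚ)) / n) *
    ∏ ℓ ∈ n.primeFactors, (1 - (jacobiSym (((a : ZMod n).val : ℤ)) ℓ : ℚ)) / 2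

/-- "`x ≡ 0 (mod 2)`" for a rational `x`: zero or positive `2`-adic valuation. -/
def IsEvenRat (x : ℚ) : Prop := x = 0 ∨ 1 ≤ padicValRat 2 x

/-- "`x` is a `2`-adic unit" (odd numerator and denominator). -/
def IsOddRat (x : ℚ) : Prop := x ≠ 0 ∧ padicValRat 2 x = 0

/-- **`δ`-minimality at two** (Kurihara 2014 §1.1 / Sakamoto 2022 Def. 1.4 transposed to `p = 2` on
the rational sums): `κ_d` is a `2`-adic unit and `κ_e ≡ 0 (mod 2)` for every proper divisor `e ∣ d`. -/
def IsDeltaMinimalTwo (d : ℕ) [NeZero d] : Prop :=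
  IsOddRat (kuriharaSumTwo f d) ∧
    ∀ (e : ℕ) (he : e ∈ d.properDivisors),
      (haveI : NeZero e := ⟨(Nat.pos_of_mem_properDivisors he).ne'⟩
       IsEvenRat (kuriharaSumTwo f e))

end Rational

/-! ## §2 The dictionary (targets; provable from `[r+1]⁺ = [r]⁺`, the Hecke relation
`∑_{j mod ℓ} [(r+j)/ℓ]⁺ + [ℓ r]⁺ = a_ℓ [r]⁺`, and `[−r]⁺ = [r]⁺`) -/

section Dictionary

/-- **K2-A1 (target/support): prime level.**  For a newform `f` of `E` (`IsNewformOf W f`) and a prime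
`ℓ ∤ 2N`:  `2·κ_ℓ(f) = (a_ℓ − 2)·[0]⁺_f − T_ℓ(f)`, and `T_ℓ(f) = 0` when `ℓ ≡ 3 (mod 4)` (odd
character against even symbols).  Checked numerically on 15 562 `(E, ℓ)` pairs (table KUR2-v1, via
Cremona `allbsd`, `N·ℓ² < 5·10⁵`). -/
@[conjecture] def PrimeLevelDictionary : Prop :=
  ∀ (W : WeierstrassCurve ℚ) [W.IsElliptic] [W.IsGloballyMinimal] {N : ℕ} [NeZero N]
    (f : CuspForm (Gamma0 N) 2),
    IsNewformOf W f → ∀ (ℓ : ℕ) [Fact ℓ.Prime], ¬ ℓ ∣ 2 * N →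
      2 * kuriharaSumTwo f ℓ =
          (W.frobeniusTrace ℓ - 2 : ℚ) * ratPlusSymbol f 0 - twistSymbolSum f ℓ ∧
        (ℓ % 4 = 3 → twistSymbolSum f ℓ = 0)

/-- **K2-A2 (target/support): pair level.**  For primes `ℓ₁ ≠ ℓ₂`, `ℓᵢ ∤ 2N`:
`4·κ_{ℓ₁ℓ₂} = (a₁−2)(a₂−2)[0]⁺ − (a₂ − 2(ℓ₂/ℓ₁))·T_{ℓ₁} − (a₁ − 2(ℓ₁/ℓ₂))·T_{ℓ₂} + T_{ℓ₁ℓ₂}`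
(`aᵢ = a_{ℓᵢ}`; the coefficients are the Euler factors `P_ℓ(χ(ℓ))` of the norm relations).  Checked on
534 `(E, ℓ₁ℓ₂)` pairs (KUR2-v1). -/
@[conjecture] def PairLevelDictionary : Prop :=
  ∀ (W : WeierstrassCurve ℚ) [W.IsElliptic] [W.IsGloballyMinimal] {N : ℕ} [NeZero N]
    (f : CuspForm (Gamma0 N) 2),
    IsNewformOf W f → ∀ (ℓ₁ ℓ₂ : ℕ) [Fact ℓ₁.Prime] [Fact ℓ₂.Prime], ℓ₁ ≠ ℓ₂ →
      ¬ ℓ₁ ∣ 2 * N → ¬ ℓ₂ ∣ 2 * N →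
      (haveI : NeZero (ℓ₁ * ℓ₂) := ⟨mul_ne_zero (Fact.out : ℓ₁.Prime).ne_zero (Fact.out : ℓ₂.Prime).ne_zero⟩
       4 * kuriharaSumTwo f (ℓ₁ * ℓ₂)) =
        (W.frobeniusTrace ℓ₁ - 2 : ℚ) * (W.frobeniusTrace ℓ₂ - 2) * ratPlusSymbol f 0
          - (W.frobeniusTrace ℓ₂ - 2 * jacobiSym ℓ₂ ℓ₁ : ℚ) * twistSymbolSum f ℓ₁
          - (W.frobeniusTrace ℓ₁ - 2 * jacobiSym ℓ₁ ℓ₂ : ℚ) * twistSymbolSum f ℓ₂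
          + twistSymbolSum f (ℓ₁ * ℓ₂)

end Dictionary

/-! ## §3 Levels at two, hypotheses, and the structure statements -/

section Structure

variable (W : WeierstrassCurve ℚ) [W.IsElliptic] [W.IsGloballyMinimal]

/-- **Levels at two** `𝒩^{(1)}` (Kurihara's `𝒫^{(N)}`-products transposed to `p = 2`, with the
cyclicity clause of Sakamoto's `IsLevel`): square-free `d`, every prime `ℓ ∣ d` has `ℓ ∤ 2N_E` and
`#Ẽ(𝔽_ℓ)[2] = 2` — the reduction has EXACTLY one `𝔽_ℓ`-rational point of order two, i.e. `Frob_ℓ` is a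
transposition on `E[2]` ("`τ`-prime": `a_ℓ` even and `(Δ_E/ℓ) = −1`).  Primes with full `2`-torsion
mod `ℓ` (`Frob_ℓ = 1`) satisfy Kato's `IsKolyvaginPrime W 2 1 ℓ` but are NOT levels (data: they never
carry an odd Kurihara number at depth `= s₂`). -/
def IsLevelAtTwo (d : ℕ) : Prop :=
  Squarefree d ∧
    ∀ (ℓ : ℕ) [Fact ℓ.Prime], ℓ ∣ d →
      ¬ ℓ ∣ 2 * W.conductorNorm ℤ ∧
      Nat.card {P : ((WeierstrassCurve.integralModelInt W).map
          (Int.castRingHom (ZMod ℓ))).toAffine.Point // 2 • P = 0} = 2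

/-- **Hypotheses at two** for the F1 good-supersingular block (mirror of Sakamoto's Lemma 9.9 list at
`p = 3`, minus the clause `E(ℚ_ℓ)[2] = 0` at bad `ℓ`, which fails at every multiplicative prime and is
not supported by the data): `ρ_{E,2^∞}` onto `GL₂(ℤ₂)`; good reduction at `2`; non-anomalous at `2`,
`2 ∤ #Ẽ(𝔽₂)` (⟺ supersingular at `2`; gives `E(ℚ₂)[2] = 0`); `2 ∤ ∏ c_ℓ`. -/
structure HypothesesAtTwo : Prop where
  surj : ∀ n : ℕ, W.HasSurjectiveModNGaloisRep ((2 ^ n : ℕ) : ℤ)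
  good : W.HasGoodReductionAtPrime 2
  nonanomalous : ¬ 2 ∣ reductionPointCount W 2
  tamagawa : ¬ 2 ∣ W.tamagawaProduct

/-- Period transfer at `2`: `Ω(W) = u·Ω⁺_f` with `|u|₂ = 1` (odd Manin constant — Abbes–Ullmo for
`2 ∤ N` — and odd isogeny index). -/
def PeriodTransferAtTwo {N : ℕ} (f : CuspForm (Gamma0 N) 2) : Prop :=
  ∃ u : ℚ, ‖(u : ℚ_[2])‖ = 1 ∧ W.realPeriodRat = u * plusPeriod f

/-- **K2-B (target, root-number forcing): the first Kolyvagin layer vanishes identically.**  If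
`w(E) = +1`, `2 ∤ ∏ c_ℓ` and every prime has `v_q(Δ_min) ≡ v_q(N)` (mod 2) (automatic for `q ∤ 6` when
`c_q` is odd), then for every level prime `ℓ ≡ 1 (mod 4)` the twist `E^{(ℓ)}` has root number `−1`, so
`T_ℓ(f) = 0` and `κ_ℓ = (a_ℓ − 2)[0]⁺/2`: NO information at depth one.  (Data: 0 exceptions among the
X5 rows; the mechanism `(Δ_E/ℓ) = −1 = (N/ℓ)·w`-bookkeeping.) -/
@[conjecture] def LayerOneVanishingAtTwo : Prop :=
  ∀ (W : WeierstrassCurve ℚ) [W.IsElliptic] [W.IsGloballyMinimal] {N : ℕ} [NeZero N]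
    (f : CuspForm (Gamma0 N) 2), IsNewformOf W f → W.rootNumber = 1 →
    (∀ q : ℕ, q.Prime →
      (Even (padicValInt q W.minimalDiscriminantInt) ↔ Even (padicValNat q (W.conductorNorm ℤ)))) →
    ∀ (ℓ : ℕ) [Fact ℓ.Prime], ℓ % 4 = 1 → IsLevelAtTwo W ℓ →
      (W.quadraticTwist (ℓ : ℚ)).rootNumber = -1 ∧ twistSymbolSum f ℓ = 0 ∧
        2 * kuriharaSumTwo f ℓ = (W.frobeniusTrace ℓ - 2 : ℚ) * ratPlusSymbol f 0

/-- **K2-C (candidate crux = Kurihara's structure conjecture at `p = 2`, cardinality form).**  Under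
`HypothesesAtTwo`, the period transfer, for every level `d ∈ 𝒩^{(1)}` that is `δ`-minimal for the
rational Kurihara sums at two: `#Sel^{(2)}(E/ℚ) = 2^{ν(d)}`.  Kurihara 2014 Thm 2/Conj, Kim 2022,
Sakamoto 2024 Thm 9.11(2) are `p ≥ 5`, `p ≥ 5`, `p = 3`; `p = 2` is not in print
(Kim: "the `p ≥ 5` condition is required only for the Chebotarev density type argument"). -/
@[conjecture] def KuriharaStructureAtTwo : Prop :=
  ∀ (W : WeierstrassCurve ℚ) [W.IsElliptic] [W.IsGloballyMinimal], HypothesesAtTwo W →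
    ∀ {N : ℕ} [NeZero N] (f : CuspForm (Gamma0 N) 2), IsNewformOf W f → PeriodTransferAtTwo W f →
    ∀ (d : ℕ) [NeZero d], IsLevelAtTwo W d → IsDeltaMinimalTwo f d →
      Nat.card (selmerGroup W 2) = 2 ^ d.primeFactors.card

/-- **K2-C₂ (the depth-two slice — the one with a proof path at `p = 2`).**  Same, for `d = ℓ₁ℓ₂` a
product of two level primes with `ℓ₁ℓ₂ ≡ 1 (mod 4)` and `w(E) = +1`: `ℓ₁ℓ₂` `δ`-minimal
(`κ_{ℓ₁ℓ₂}` odd, `κ_1, κ_{ℓ₁}, κ_{ℓ₂}` even) ⟹ `#Sel^{(2)}(E/ℚ) = 4`.  (The v0 typing with only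
"`κ_{ℓ₁ℓ₂}` odd" is REFUTED by the table rows 27a1·85 and 37b1·65: `s₂ = 0`, `κ_1` odd, `κ_{85}`,
`κ_{65}` odd.)  Witness rows: 571a1 (`a₂ = 0`, rank 0, `Ш_an = 4`) at `n = 21`: `κ_21 = 1`,
`L^{alg}(E^{(21)}) = 4`, rank `E^{(21)} = 0`; 433a1, 571b1 (rank 2) at `n = 33, 21`: `κ = 1`.  Proof path: K2-A2 + K2-B give `4κ_{ℓ₁ℓ₂} ≡ T_{ℓ₁ℓ₂} = L^{alg}(E^{(ℓ₁ℓ₂)})`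
(mod `2^{≥5}`); `κ` odd ⟹ `v₂ L^{alg}(E^{(ℓ₁ℓ₂)}) = 2 = v₂(c_{ℓ₁}c_{ℓ₂})` ⟹ [rank-0 `2`-adic Kato/BSD
upper bound for the TWIST] `Sel₂(E^{(ℓ₁ℓ₂)}) = 0` ⟹ [Kramer / KMR comparison in `H¹(ℚ,E[2])`]
`Sel₂(E) ↪ E(ℚ_{ℓ₁})/2 ⊕ E(ℚ_{ℓ₂})/2`. -/
@[conjecture] def KuriharaStructureAtTwoDepthTwo : Prop :=
  ∀ (W : WeierstrassCurve ℚ) [W.IsElliptic] [W.IsGloballyMinimal], HypothesesAtTwo W →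
    W.rootNumber = 1 →
    ∀ {N : ℕ} [NeZero N] (f : CuspForm (Gamma0 N) 2), IsNewformOf W f → PeriodTransferAtTwo W f →
    ∀ (ℓ₁ ℓ₂ : ℕ) [Fact ℓ₁.Prime] [Fact ℓ₂.Prime], ℓ₁ ≠ ℓ₂ → (ℓ₁ * ℓ₂) % 4 = 1 →
      IsLevelAtTwo W (ℓ₁ * ℓ₂) →
      (haveI : NeZero (ℓ₁ * ℓ₂) := ⟨mul_ne_zero (Fact.out : ℓ₁.Prime).ne_zero (Fact.out : ℓ₂.Prime).ne_zero⟩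
       IsDeltaMinimalTwo f (ℓ₁ * ℓ₂)) →
      Nat.card (selmerGroup W 2) = 4

/-- **K2-D (candidate, falsifiable by one row): the depth law at two.**  Under `HypothesesAtTwo` and the
period transfer, a level `d` with `2^{ν(d)} < #Sel^{(2)}(E/ℚ)` carries an EVEN Kurihara sum.  Table
KUR2-v1: 0 violations on 16 096 `(E, d)` pairs, `ν(d) ≤ 2` (723 of them with `ν(d) < s₂(E)`), all
reduction types at `2`. -/
@[conjecture] def KuriharaDepthLawAtTwo : Prop :=
  ∀ (W : WeierstrassCurve ℚ) [W.IsElliptic] [W.IsGloballyMinimal], HypothesesAtTwo W →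
    ∀ {N : ℕ} [NeZero N] (f : CuspForm (Gamma0 N) 2), IsNewformOf W f → PeriodTransferAtTwo W f →
    ∀ (d : ℕ) [NeZero d], IsLevelAtTwo W d →
      2 ^ d.primeFactors.card < Nat.card (selmerGroup W 2) → IsEvenRat (kuriharaSumTwo f d)

/-- **K2-E (candidate, the Tamagawa defect at two; a BSD-bookkeeping tautology at `ν ≤ 1`).**  If some
`c_q` is even then EVERY Kurihara sum at two is even (Kato's Kolyvagin system mod `2` is imprimitive):
0 exceptions on the 8 967 `(E, d)` pairs with `2 ∣ ∏ c_q` in KUR2-v1.  Mechanism at `ν = 1`: parity of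
each `c_q` is invariant under unramified quadratic twists and `c_ℓ(E^{(ℓ)}) = #Ẽ(𝔽_ℓ)[2]`. -/
@[conjecture] def TamagawaDefectAtTwo : Prop :=
  ∀ (W : WeierstrassCurve ℚ) [W.IsElliptic] [W.IsGloballyMinimal] {N : ℕ} [NeZero N]
    (f : CuspForm (Gamma0 N) 2), IsNewformOf W f → PeriodTransferAtTwo W f →
    W.HasIrreducibleModPGaloisRep 2 → 2 ∣ W.tamagawaProduct →
    ∀ (d : ℕ) [NeZero d], IsLevelAtTwo W d → IsEvenRat (kuriharaSumTwo f d)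

end Structure

/-! ## §4 Sanity lemmas (cheap, proved) -/

/-- `κ_1 = [0]⁺` for the rational sum at two (the `n = 1` case: one unit, empty product). -/
theorem kuriharaSumTwo_one {N : ℕ} (f : CuspForm (Gamma0 N) 2) :
    kuriharaSumTwo f 1 = ratPlusSymbol f 0 := by
  haveI : Subsingleton (ZMod 1) := ZMod.subsingleton_iff.mpr rfl
  haveI : Subsingleton (ZMod 1)ˣ := ⟨fun a b ↦ Units.ext (Subsingleton.elim _ _)⟩
  rw [kuriharaSumTwo, Fintype.sum_subsingleton _ 1]
  simp [Nat.primeFactors_one]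

/-- The depth law is implied by the structure statement when the lower levels are known even: if `d`
is a level with all proper-divisor sums even and `2^{ν(d)} < #Sel₂`, then `κ_d` cannot be odd. -/
theorem not_isOddRat_of_structure {W : WeierstrassCurve ℚ} [W.IsElliptic] [W.IsGloballyMinimal]
    (hS : KuriharaStructureAtTwo) (hW : HypothesesAtTwo W) {N : ℕ} [NeZero N]
    {f : CuspForm (Gamma0 N) 2} (hf : IsNewformOf W f) (hper : PeriodTransferAtTwo W f)
    {d : ℕ} [NeZero d] (hd : IsLevelAtTwo W d)
    (hlow : ∀ (e : ℕ) (he : e ∈ d.properDivisors),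
      (haveI : NeZero e := ⟨(Nat.pos_of_mem_properDivisors he).ne'⟩
       IsEvenRat (kuriharaSumTwo f e)))
    (hlt : 2 ^ d.primeFactors.card < Nat.card (selmerGroup W 2)) :
    ¬ IsOddRat (kuriharaSumTwo f d) := by
  intro hodd
  have h := hS W hW f hf hper d hd ⟨hodd, hlow⟩
  omega

end Summit.BirchSwinnertonDyer.Rank1Residual.F1Sign2
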